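import Mathlib
import Summits.Ventures.PercRepro2.V2SP
import Summits.Ventures.PercRepro2.Tail2DCount
import Summits.Ventures.PercRepro2.Tail2DThreePoint
import Summits.Ventures.PercRepro2.Tail2DP2Series
import Summits.Ventures.PercRepro2.Tail2DDisjointPaths
import Summits.Ventures.PercRepro2.Tail2DThirdAlgebra

/-!
# The third transport inequality on every series–parallel network (seat mine-b, cell pub-perc-repro2)

For a pattern `Y` of the cell's grammar, uniformly two-coloured, write `M = #Conf`, `P = #{r = 0}`,
`Q = #{r = 1}`, `Z = #{r = b = 0}`, `a₁ = #{r ≥ 1}`, `a₂ = #{r ≥ 2}`, `c = #{r ≥ 1 ∧ b ≥ 1}`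
(`r`, `b` the red and blue `s–t` max-flows). The transport rule `MTailPat.par_p2ser` puts
`P(e²) ∧ Y` into the M♮ class under nine inequalities on these counts; with the colour symmetry they
reduce to `#{r ≥ 2} ≤ #{r ≥ 1 ∧ b ≥ 1}` (`disjoint_le_conn`) and to the THIRD inequality

  `(III)   n₀₀ · n₁₁ ≤ n₁₀ · (n₁₀ + n₂₀)`,   i.e.   `(2P + 2Z) · 2c ≤ (Q + 2X)² + (Q + 2X) · a₂`,

`X = #{r ≥ 1, b = 0} = P − Z`. This file proves (III) on EVERY pattern (`third_count`).

The inequality itself is not closed under the series–parallel recursion (registry §35); the proof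
goes through two invariants that are, both established by induction over the grammar:

* HARRIS `harris_count`: `Z · M ≤ P²` (equivalently `c · M ≤ a₁²`): both sides multiply under
  series (`c`, `a₁`) and under parallel (`Z`, `P`).
* BK′ `bk_count`: `4 a₂ M⁴ ≤ a₁² (2M³ + a₁M² + a₁³)`, the bound `P(r ≥ 2) ≤ P(r ≥ 1)² · φ(P(r ≥ 1))`
  with `φ(a) = (2 + a + a³)/4`, a strengthening of the van den Berg–Kesten bound `P(A ∘ A) ≤ P(A)²` on
  these networks. Under series `a₁`, `a₂`, `M` multiply and the closure is Chebyshev's sum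
  inequality for the similarly ordered sequences `M³ ≥ a₁M² ≥ a₁³` (`bk_ser_alg`); under parallel the
  dual form `4QM⁴ ≥ a₁ P (4M³ + 2a₁M² + a₁²M + a₁³)` and `Q'' = QP' + PQ'` reduce it to a
  two-variable polynomial inequality with the explicit certificate of `bk_par_alg`
  (the algebra lives in `Tail2DThirdAlgebra.lean`).

Then `4 M⁵ · [(III)-slack] = [BK′-slack]·(3a₁ − 2c)·M + [Harris-slack]·(32M⁵ − 2a₁²(2M³ + a₁M² + a₁³))
+ a₁²(M − a₁)²(2a₁³ + a₁²M + 2a₁M² + 4M³)` (`third_alg`), every term non-negative. In the normalised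
variables `ρ = c M / a₁²` (Harris ratio) and `σ = a₂ M / a₁²` (BK ratio) this reads
`9 − 8ρ − 3σa + 2ρσa² ≥ 0`, and `φ` is a least-degree polynomial with non-negative coefficients
summing to one (series closure by Chebyshev) whose parallel closure holds (`φ(0) ≥ 1/2`, then the
linear coefficient `≥ 1/6`) and for which `φ(a)·a(3 − 2a) ≤ 1` (here `4 − a(3−2a)(2 + a + a³) =
(1 − a)²(2a³ + a² + 2a + 4)`).
-/

namespace Summit.Ventures.PercRepro2.Tail2D

open V2Closure

/-! ### Counts -/

section Counts

variable (s : V2Closure.SP)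

/-- `#{r ≥ 1} + #{r = 0} = #Conf` -/
lemma card_r1_add :
    (Finset.univ.filter (fun y : s.Conf => 1 ≤ s.rLab y)).card + (Finset.univ.filter (fun y : s.Conf => s.rLab y = 0)).card
      = Fintype.card s.Conf := by
  rw [Finset.card_filter, Finset.card_filter, ← Finset.card_univ, Finset.card_eq_sum_ones, ← Finset.sum_add_distrib]
  refine Finset.sum_congr rfl (fun y _ => ?_)
  split_ifs <;> omega

/-- `#{r = 1} + #{r ≥ 2} = #{r ≥ 1}` -/
lemma card_r1_split :
    (Finset.univ.filter (fun y : s.Conf => s.rLab y = 1)).card + (Finset.univ.filter (fun y : s.Conf => 2 ≤ s.rLab y)).card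
      = (Finset.univ.filter (fun y : s.Conf => 1 ≤ s.rLab y)).card := by
  rw [Finset.card_filter, Finset.card_filter, Finset.card_filter, ← Finset.sum_add_distrib]
  refine Finset.sum_congr rfl (fun y _ => ?_)
  split_ifs <;> omega

/-- `#{r ≥ 1 ∧ b = 0} + #{r = 0 ∧ b = 0} = #{b = 0}` -/
lemma card_x_add :
    (Finset.univ.filter (fun y : s.Conf => 1 ≤ s.rLab y ∧ s.bLab y = 0)).card
      + (Finset.univ.filter (fun y : s.Conf => s.rLab y = 0 ∧ s.bLab y = 0)).card
      = (Finset.univ.filter (fun y : s.Conf => s.bLab y = 0)).card := by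
  rw [Finset.card_filter, Finset.card_filter, Finset.card_filter, ← Finset.sum_add_distrib]
  refine Finset.sum_congr rfl (fun y _ => ?_)
  split_ifs <;> omega

/-- `#{r ≥ 1 ∧ b ≥ 1} ≤ #{r ≥ 1}` -/
lemma card_conn_le_r1 :
    (Finset.univ.filter (fun y : s.Conf => 1 ≤ s.rLab y ∧ 1 ≤ s.bLab y)).card
      ≤ (Finset.univ.filter (fun y : s.Conf => 1 ≤ s.rLab y)).card :=
  Finset.card_le_card (fun y hy => by simp only [Finset.mem_filter] at hy ⊢; exact ⟨hy.1, hy.2.1⟩)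

/-- every pattern has a configuration -/
lemma card_conf_pos : ∀ s : V2Closure.SP, 0 < Fintype.card s.Conf
  | .free => by decide
  | .pin => by decide
  | .absent => by decide
  | .ser s t => by
    change 0 < Fintype.card (s.Conf × t.Conf)
    rw [Fintype.card_prod]; exact Nat.mul_pos (card_conf_pos s) (card_conf_pos t)
  | .par s t => by
    change 0 < Fintype.card (s.Conf × t.Conf)
    rw [Fintype.card_prod]; exact Nat.mul_pos (card_conf_pos s) (card_conf_pos t)

end Counts

section Product

variable (s t : V2Closure.SP)

/-- `#Conf` of a series composition is the product -/
lemma card_conf_ser : Fintype.card (V2Closure.SP.ser s t).Conf = Fintype.card s.Conf * Fintype.card t.Conf := by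
  change Fintype.card (s.Conf × t.Conf) = _; exact Fintype.card_prod _ _

/-- `#Conf` of a parallel composition is the product -/
lemma card_conf_par : Fintype.card (V2Closure.SP.par s t).Conf = Fintype.card s.Conf * Fintype.card t.Conf := by
  change Fintype.card (s.Conf × t.Conf) = _; exact Fintype.card_prod _ _

/-- series: `#{r ≥ 1}` multiplies -/
lemma card_r1_ser :
    (Finset.univ.filter (fun y : (V2Closure.SP.ser s t).Conf => 1 ≤ (V2Closure.SP.ser s t).rLab y)).card
      = (Finset.univ.filter (fun y : s.Conf => 1 ≤ s.rLab y)).card * (Finset.univ.filter (fun y : t.Conf => 1 ≤ t.rLab y)).card := by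
  simp only [Finset.card_filter]
  rw [← sum_prod_ite s t (fun a => 1 ≤ s.rLab a) (fun b => 1 ≤ t.rLab b)]
  refine Finset.sum_congr rfl (fun y _ => ?_)
  simp only [SP.rLab, serR]
  split_ifs <;> omega

/-- parallel: `#{r = 0}` multiplies -/
lemma card_r0_par :
    (Finset.univ.filter (fun y : (V2Closure.SP.par s t).Conf => (V2Closure.SP.par s t).rLab y = 0)).card
      = (Finset.univ.filter (fun y : s.Conf => s.rLab y = 0)).card * (Finset.univ.filter (fun y : t.Conf => t.rLab y = 0)).card := by
  simp only [Finset.card_filter]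
  rw [← sum_prod_ite s t (fun a => s.rLab a = 0) (fun b => t.rLab b = 0)]
  change (∑ y : s.Conf × t.Conf, if s.rLab y.1 + t.rLab y.2 = 0 then 1 else 0) = _
  refine Finset.sum_congr rfl (fun y _ => ?_)
  split_ifs <;> omega

/-- parallel: `#{r = b = 0}` multiplies -/
lemma card_z_par :
    (Finset.univ.filter (fun y : (V2Closure.SP.par s t).Conf =>
        (V2Closure.SP.par s t).rLab y = 0 ∧ (V2Closure.SP.par s t).bLab y = 0)).card
      = (Finset.univ.filter (fun y : s.Conf => s.rLab y = 0 ∧ s.bLab y = 0)).card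
        * (Finset.univ.filter (fun y : t.Conf => t.rLab y = 0 ∧ t.bLab y = 0)).card := by
  simp only [Finset.card_filter]
  rw [← sum_prod_ite s t (fun a => s.rLab a = 0 ∧ s.bLab a = 0) (fun b => t.rLab b = 0 ∧ t.bLab b = 0)]
  change (∑ y : s.Conf × t.Conf, if s.rLab y.1 + t.rLab y.2 = 0 ∧ s.bLab y.1 + t.bLab y.2 = 0 then 1 else 0) = _
  refine Finset.sum_congr rfl (fun y _ => ?_)
  split_ifs <;> omega

/-- parallel: `#{r = 1} = Q P' + P Q'` -/
lemma card_r1_par :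
    (Finset.univ.filter (fun y : (V2Closure.SP.par s t).Conf => (V2Closure.SP.par s t).rLab y = 1)).card
      = (Finset.univ.filter (fun y : s.Conf => s.rLab y = 1)).card * (Finset.univ.filter (fun y : t.Conf => t.rLab y = 0)).card
        + (Finset.univ.filter (fun y : s.Conf => s.rLab y = 0)).card * (Finset.univ.filter (fun y : t.Conf => t.rLab y = 1)).card := by
  simp only [Finset.card_filter]
  rw [← sum_prod_ite s t (fun a => s.rLab a = 1) (fun b => t.rLab b = 0),
    ← sum_prod_ite s t (fun a => s.rLab a = 0) (fun b => t.rLab b = 1)]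
  change (∑ y : s.Conf × t.Conf, if s.rLab y.1 + t.rLab y.2 = 1 then 1 else 0) = _ + _
  rw [← Finset.sum_add_distrib]
  refine Finset.sum_congr rfl (fun y _ => ?_)
  split_ifs <;> omega

end Product

/-! ### The two invariants -/

/-- **Harris on every pattern**: `#{r = b = 0} · #Conf ≤ #{r = 0}²` (the events `{r = 0}` and
`{b = 0}` are negatively correlated; `#{b = 0} = #{r = 0}` by the colour swap). -/
theorem harris_count : ∀ s : V2Closure.SP,
    (Finset.univ.filter (fun y : s.Conf => s.rLab y = 0 ∧ s.bLab y = 0)).card * Fintype.card s.Conf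
      ≤ (Finset.univ.filter (fun y : s.Conf => s.rLab y = 0)).card ^ 2
  | .free => by decide
  | .pin => by decide
  | .absent => by decide
  | .ser s t => by
    -- in the primal form `c · M ≤ a₁²`, both sides multiply
    have hs := harris_count s
    have ht := harris_count t
    have es := card_conn_add s
    have et := card_conn_add t
    have fs := card_r1_add s
    have ft := card_r1_add t
    have e := card_conn_add (V2Closure.SP.ser s t)
    have f := card_r1_add (V2Closure.SP.ser s t)
    rw [card_b0_eq_r0 s] at es
    rw [card_b0_eq_r0 t] at et
    rw [card_b0_eq_r0 (V2Closure.SP.ser s t), card_conn_ser, card_conf_ser] at e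
    rw [card_r1_ser, card_conf_ser] at f
    rw [card_conf_ser]
    set Z := (Finset.univ.filter (fun y : (V2Closure.SP.ser s t).Conf =>
      (V2Closure.SP.ser s t).rLab y = 0 ∧ (V2Closure.SP.ser s t).bLab y = 0)).card
    set P := (Finset.univ.filter (fun y : (V2Closure.SP.ser s t).Conf => (V2Closure.SP.ser s t).rLab y = 0)).card
    set Zs := (Finset.univ.filter (fun y : s.Conf => s.rLab y = 0 ∧ s.bLab y = 0)).card
    set Zt := (Finset.univ.filter (fun y : t.Conf => t.rLab y = 0 ∧ t.bLab y = 0)).card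
    set Ps := (Finset.univ.filter (fun y : s.Conf => s.rLab y = 0)).card
    set Pt := (Finset.univ.filter (fun y : t.Conf => t.rLab y = 0)).card
    set Cs := (Finset.univ.filter (fun y : s.Conf => 1 ≤ s.rLab y ∧ 1 ≤ s.bLab y)).card
    set Ct := (Finset.univ.filter (fun y : t.Conf => 1 ≤ t.rLab y ∧ 1 ≤ t.bLab y)).card
    set As := (Finset.univ.filter (fun y : s.Conf => 1 ≤ s.rLab y)).card
    set At := (Finset.univ.filter (fun y : t.Conf => 1 ≤ t.rLab y)).card
    set Ms := Fintype.card s.Conf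
    set Mt := Fintype.card t.Conf
    -- primal forms of the factors
    have ps : (Cs : ℤ) * Ms ≤ As ^ 2 := by
      have h1 : (Zs : ℤ) * Ms ≤ Ps ^ 2 := by exact_mod_cast hs
      have h2 : (Cs : ℤ) + Ps + Ps = Ms + Zs := by exact_mod_cast es
      have h3 : (As : ℤ) + Ps = Ms := by exact_mod_cast fs
      have hC : (Cs : ℤ) = Ms + Zs - 2 * Ps := by linarith
      have hA : (As : ℤ) = Ms - Ps := by linarith
      rw [hC, hA]; linarith [h1]
    have pt : (Ct : ℤ) * Mt ≤ At ^ 2 := by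
      have h1 : (Zt : ℤ) * Mt ≤ Pt ^ 2 := by exact_mod_cast ht
      have h2 : (Ct : ℤ) + Pt + Pt = Mt + Zt := by exact_mod_cast et
      have h3 : (At : ℤ) + Pt = Mt := by exact_mod_cast ft
      have hC : (Ct : ℤ) = Mt + Zt - 2 * Pt := by linarith
      have hA : (At : ℤ) = Mt - Pt := by linarith
      rw [hC, hA]; linarith [h1]
    have pp : (Cs : ℤ) * Ct * (Ms * Mt) ≤ (As * At) ^ 2 := by
      have := mul_le_mul ps pt (by positivity) (by positivity)
      linarith [this]
    have h2 : (Cs : ℤ) * Ct + P + P = Ms * Mt + Z := by exact_mod_cast e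
    have h3 : (As : ℤ) * At + P = Ms * Mt := by exact_mod_cast f
    have hZ : (Z : ℤ) = Cs * Ct + 2 * P - Ms * Mt := by linarith
    have hP : (P : ℤ) = Ms * Mt - As * At := by linarith
    have : (Z : ℤ) * (Ms * Mt) ≤ (P : ℤ) ^ 2 := by
      rw [hZ, hP]; linarith [pp]
    exact_mod_cast this
  | .par s t => by
    have hs := harris_count s
    have ht := harris_count t
    rw [card_z_par, card_r0_par, card_conf_par]
    have := Nat.mul_le_mul hs ht
    nlinarith [this]

/-- **BK′ on every pattern**: `4 · #{r ≥ 2} · M⁴ ≤ #{r ≥ 1}² · (2M³ + #{r ≥ 1}·M² + #{r ≥ 1}³)`,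
i.e. `P(r ≥ 2) ≤ P(r ≥ 1)² · (2 + P(r ≥ 1) + P(r ≥ 1)³)/4`. -/
theorem bk_count : ∀ s : V2Closure.SP,
    4 * (Finset.univ.filter (fun y : s.Conf => 2 ≤ s.rLab y)).card * Fintype.card s.Conf ^ 4
      ≤ (Finset.univ.filter (fun y : s.Conf => 1 ≤ s.rLab y)).card ^ 2
        * (2 * Fintype.card s.Conf ^ 3 + (Finset.univ.filter (fun y : s.Conf => 1 ≤ s.rLab y)).card * Fintype.card s.Conf ^ 2
            + (Finset.univ.filter (fun y : s.Conf => 1 ≤ s.rLab y)).card ^ 3)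
  | .free => by decide
  | .pin => by decide
  | .absent => by decide
  | .ser s t => by
    have hs := bk_count s
    have ht := bk_count t
    have fs := card_r1_add s
    have ft := card_r1_add t
    rw [card_r2_ser, card_r1_ser, card_conf_ser]
    set Bs := (Finset.univ.filter (fun y : s.Conf => 2 ≤ s.rLab y)).card
    set Bt := (Finset.univ.filter (fun y : t.Conf => 2 ≤ t.rLab y)).card
    set As := (Finset.univ.filter (fun y : s.Conf => 1 ≤ s.rLab y)).card
    set At := (Finset.univ.filter (fun y : t.Conf => 1 ≤ t.rLab y)).card
    set Ms := Fintype.card s.Conf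
    set Mt := Fintype.card t.Conf
    have hAs : (As : ℤ) ≤ Ms := by exact_mod_cast (by omega : As ≤ Ms)
    have hAt : (At : ℤ) ≤ Mt := by exact_mod_cast (by omega : At ≤ Mt)
    have h := bk_ser_alg (Ms : ℤ) As Bs Mt At Bt (by positivity) hAs (by positivity) hAt (by positivity)
      (by exact_mod_cast hs) (by exact_mod_cast ht)
    exact_mod_cast h
  | .par s t => by
    have hs := bk_count s
    have ht := bk_count t
    have fs := card_r1_add s
    have ft := card_r1_add t
    have gs := card_r1_split s
    have gt := card_r1_split t
    have f := card_r1_add (V2Closure.SP.par s t)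
    have g := card_r1_split (V2Closure.SP.par s t)
    rw [card_r0_par, card_conf_par] at f
    rw [card_r1_par] at g
    rw [card_conf_par]
    set B := (Finset.univ.filter (fun y : (V2Closure.SP.par s t).Conf => 2 ≤ (V2Closure.SP.par s t).rLab y)).card
    set A := (Finset.univ.filter (fun y : (V2Closure.SP.par s t).Conf => 1 ≤ (V2Closure.SP.par s t).rLab y)).card
    set Bs := (Finset.univ.filter (fun y : s.Conf => 2 ≤ s.rLab y)).card
    set Bt := (Finset.univ.filter (fun y : t.Conf => 2 ≤ t.rLab y)).card
    set As := (Finset.univ.filter (fun y : s.Conf => 1 ≤ s.rLab y)).card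
    set At := (Finset.univ.filter (fun y : t.Conf => 1 ≤ t.rLab y)).card
    set Ps := (Finset.univ.filter (fun y : s.Conf => s.rLab y = 0)).card
    set Pt := (Finset.univ.filter (fun y : t.Conf => t.rLab y = 0)).card
    set Qs := (Finset.univ.filter (fun y : s.Conf => s.rLab y = 1)).card
    set Qt := (Finset.univ.filter (fun y : t.Conf => t.rLab y = 1)).card
    set Ms := Fintype.card s.Conf
    set Mt := Fintype.card t.Conf
    have hMs : (0 : ℤ) < Ms := by exact_mod_cast card_conf_pos s
    have hMt : (0 : ℤ) < Mt := by exact_mod_cast card_conf_pos t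
    have hPs : (Ps : ℤ) = Ms - As := by
      have : (As : ℤ) + Ps = Ms := by exact_mod_cast fs
      linarith
    have hPt : (Pt : ℤ) = Mt - At := by
      have : (At : ℤ) + Pt = Mt := by exact_mod_cast ft
      linarith
    have hAs : (As : ℤ) ≤ Ms := by linarith [hPs, (by positivity : (0 : ℤ) ≤ Ps)]
    have hAt : (At : ℤ) ≤ Mt := by linarith [hPt, (by positivity : (0 : ℤ) ≤ Pt)]
    -- dual forms of the factors: `a₁ P (4M³ + 2a₁M² + a₁²M + a₁³) ≤ 4 Q M⁴`
    have ds : (As : ℤ) * (Ms - As) * (4 * Ms ^ 3 + 2 * As * Ms ^ 2 + As ^ 2 * Ms + As ^ 3) ≤ 4 * Qs * Ms ^ 4 := by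
      have h1 : 4 * (Bs : ℤ) * Ms ^ 4 ≤ As ^ 2 * (2 * Ms ^ 3 + As * Ms ^ 2 + As ^ 3) := by exact_mod_cast hs
      have h2 : (Qs : ℤ) + Bs = As := by exact_mod_cast gs
      have hB : (Bs : ℤ) = As - Qs := by linarith
      rw [hB] at h1; linarith [h1]
    have dt : (At : ℤ) * (Mt - At) * (4 * Mt ^ 3 + 2 * At * Mt ^ 2 + At ^ 2 * Mt + At ^ 3) ≤ 4 * Qt * Mt ^ 4 := by
      have h1 : 4 * (Bt : ℤ) * Mt ^ 4 ≤ At ^ 2 * (2 * Mt ^ 3 + At * Mt ^ 2 + At ^ 3) := by exact_mod_cast ht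
      have h2 : (Qt : ℤ) + Bt = At := by exact_mod_cast gt
      have hB : (Bt : ℤ) = At - Qt := by linarith
      rw [hB] at h1; linarith [h1]
    have key := bk_par_alg (Ms : ℤ) As Qs Mt At Qt (by positivity) hAs (by positivity) hAt hMs hMt ds dt
    -- translate back: `A = M M' − P P'`, `B = A − (Q P' + P Q')`
    have hA : (A : ℤ) = Ms * Mt - Ps * Pt := by
      have : (A : ℤ) + Ps * Pt = Ms * Mt := by exact_mod_cast f
      linarith
    have hB : (B : ℤ) = A - (Qs * Pt + Ps * Qt) := by
      have : (Qs * Pt + Ps * Qt : ℤ) + B = A := by exact_mod_cast g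
      linarith
    have goal : 4 * (B : ℤ) * (Ms * Mt) ^ 4 ≤ (A : ℤ) ^ 2 * (2 * (Ms * Mt) ^ 3 + A * (Ms * Mt) ^ 2 + A ^ 3) := by
      rw [hB, hA, hPs, hPt]
      linarith [key]
    exact_mod_cast goal

/-! ### The third inequality -/

/-- **The third transport inequality on every pattern**, in the six-count form of `MTailPat.par_p2ser`:
`(#{r = 0} + #{b = 0} + 2·#{r = b = 0}) · (2·#{r ≥ 1 ∧ b ≥ 1})
  ≤ (#{r = 1} + 2·#{r ≥ 1 ∧ b = 0})² + (#{r = 1} + 2·#{r ≥ 1 ∧ b = 0}) · #{r ≥ 2}`. -/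
theorem third_count (s : V2Closure.SP) :
    (stat s (fun r _ => r = 0) + stat s (fun _ b => b = 0) + 2 * stat s (fun r b => r = 0 ∧ b = 0))
        * (2 * stat s (fun r b => 1 ≤ r ∧ 1 ≤ b))
      ≤ (stat s (fun r _ => r = 1) + 2 * stat s (fun r b => 1 ≤ r ∧ b = 0))
          * (stat s (fun r _ => r = 1) + 2 * stat s (fun r b => 1 ≤ r ∧ b = 0))
        + (stat s (fun r _ => r = 1) + 2 * stat s (fun r b => 1 ≤ r ∧ b = 0)) * stat s (fun r _ => 2 ≤ r) := by
  simp only [stat]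
  have hH := harris_count s
  have hB := bk_count s
  have e1 := card_r1_add s
  have e2 := card_r1_split s
  have e3 := card_conn_add s
  have e4 := card_x_add s
  have e5 := card_conn_le_r1 s
  have e6 := card_conf_pos s
  rw [card_b0_eq_r0 s] at e3 e4 ⊢
  set M := Fintype.card s.Conf
  set P := (Finset.univ.filter (fun y : s.Conf => s.rLab y = 0)).card
  set Q := (Finset.univ.filter (fun y : s.Conf => s.rLab y = 1)).card
  set Z := (Finset.univ.filter (fun y : s.Conf => s.rLab y = 0 ∧ s.bLab y = 0)).card
  set X := (Finset.univ.filter (fun y : s.Conf => 1 ≤ s.rLab y ∧ s.bLab y = 0)).card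
  set A := (Finset.univ.filter (fun y : s.Conf => 1 ≤ s.rLab y)).card
  set B := (Finset.univ.filter (fun y : s.Conf => 2 ≤ s.rLab y)).card
  set C := (Finset.univ.filter (fun y : s.Conf => 1 ≤ s.rLab y ∧ 1 ≤ s.bLab y)).card
  have hP : (A : ℤ) + P = M := by exact_mod_cast e1
  have hQ : (Q : ℤ) + B = A := by exact_mod_cast e2
  have hZ : (C : ℤ) + P + P = M + Z := by exact_mod_cast e3
  have hX : (X : ℤ) + Z = P := by exact_mod_cast e4
  have hCA : (C : ℤ) ≤ A := by exact_mod_cast e5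
  have hM : (0 : ℤ) < M := by exact_mod_cast e6
  have hH' : (C : ℤ) * M ≤ A ^ 2 := by
    have h1 : (Z : ℤ) * M ≤ P ^ 2 := by exact_mod_cast hH
    have hC : (C : ℤ) = M + Z - 2 * P := by linarith
    have hA : (A : ℤ) = M - P := by linarith
    rw [hC, hA]; linarith [h1]
  have hB' : 4 * (B : ℤ) * M ^ 4 ≤ A ^ 2 * (2 * M ^ 3 + A * M ^ 2 + A ^ 3) := by exact_mod_cast hB
  have hF := third_alg (M : ℤ) A B C hM (by positivity) (by linarith [(by positivity : (0 : ℤ) ≤ P)]) hCA hH' hB'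
  have := third_count_alg (M : ℤ) A B C P Q Z X hP hQ hZ hX hF
  exact_mod_cast this

end Summit.Ventures.PercRepro2.Tail2D
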